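import Mathlib
import Literature.NumberTheory.Automorphic.MatrixOrderRatConj
import Literature.LinearAlgebra.Matrix.SmithNormalFormFinTwoInt
import HarnessLib

/-!
# The Eichler orders of `M₂(ℚ)`: an Eichler order of level `M` is conjugate to
# `O₀(M) = (ℤ ℤ; Mℤ ℤ)`

Topic `NumberTheory/Automorphic`; theorems only (no definition, no named fact, no instance). For
the split quaternion algebra `M₂(ℚ)`, every Eichler order `O = O₁ ∩ O₂` of level `M` (tree
`Brandt.IsEichlerOrder`: `O₁, O₂` maximal, `[O₁ : O] = M`) is `u O₀(M) u⁻¹` for some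
`u ∈ GL₂(ℚ)`, where `O₀(M) = (ℤ ℤ; Mℤ ℤ) = M₂(ℤ) ∩ δ M₂(ℤ) δ⁻¹`, `δ = diag(1, M)`; in
particular `M ≥ 1`. Vignéras, LNM 800, Ch. II §2 (p. 39): over a local field the Eichler orders
of `M(2,K)` are the conjugates of `O_n = (R R; πⁿR R)`; globally over `ℚ` (class number one,
here replaced by the elementary Smith normal form) the same holds with `M₂(ℤ)`:

* `Brandt.IsEichlerOrder.exists_units_forall_mem_iff` — **`∃ u ∈ GL₂(ℚ)`, `z ∈ O ↔ u⁻¹ z u` is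
  integral with `M ∣ (u⁻¹ z u)₁₀`** (predicate form of `O = u O₀(M) u⁻¹`), and
  `Brandt.IsEichlerOrder.level_pos` — `0 < M`.

Proof: the maximal orders are `gᵢ M₂(ℤ) gᵢ⁻¹` (`MatrixOrderRatLattice`); with
`k = g₁⁻¹ g₂ = (g/N) γ diag(1, q) γ'`, `γ, γ' ∈ GL₂(ℤ)` (Smith normal form of `N k`,
`SmithNormalFormFinTwoInt`), `O = g₁ γ (M₂(ℤ) ∩ δ M₂(ℤ) δ⁻¹) γ⁻¹ g₁⁻¹` (`MatrixOrderRatConj`: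
`GL₂(ℤ)` normalises `M₂(ℤ)`, scalars conjugate trivially), and the index `[M₂(ℤ) : O₀(q)] = q`
forces `q = M`. Brick "S2c" of the `D = 1` branch of the proof of
`Literature.NumberTheory.Automorphic.ShimuraCurveData.volume_fd_eq`.

## References

* M.-F. Vignéras, *Arithmétique des algèbres de quaternions*, LNM 800 (1980), Ch. II §2 (ordres
  d'Eichler), Ch. III §5 [VignerasLNM800].
* J. Voight, *Quaternion Algebras*, GTM 288 (2021), 23.4 [Voight2021].
-/

noncomputable section

open Matrix

namespace Literature.NumberTheory.Automorphic

/-! ### Helpers on conjugation of lattices -/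

/-- `(ab) L (ab)⁻¹ = a (b L b⁻¹) a⁻¹`. [folklore] -/
theorem map_unitsConj_mul {B : Type*} [Ring B] (a b : Bˣ) (L : Submodule ℤ B) :
    L.map (unitsConj (a * b) : B →ₗ[ℤ] B) =
      (L.map (unitsConj b : B →ₗ[ℤ] B)).map (unitsConj a : B →ₗ[ℤ] B) := by
  ext z
  simp only [mem_map_unitsConj_iff, _root_.mul_inv_rev, Units.val_mul, mul_assoc]

/-- `[u J u⁻¹ : u I u⁻¹] = [J : I]`. [folklore] -/
theorem relIndex_map_unitsConj {B : Type*} [Ring B] (u : Bˣ) (J I : Submodule ℤ B) :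
    (J.map (unitsConj u : B →ₗ[ℤ] B)).toAddSubgroup.relIndex (I.map (unitsConj u : B →ₗ[ℤ] B)).toAddSubgroup =
      J.toAddSubgroup.relIndex I.toAddSubgroup := by
  rw [Submodule.map_toAddSubgroup, Submodule.map_toAddSubgroup]
  exact AddSubgroup.relIndex_map_map_of_injective _ _ (unitsConj u).injective

/-- The entrywise cast of `g • diag(1, q)` is `g • diag(1, q)`. [folklore] -/
theorem map_intCast_smul_diagonal (g : ℤ) (q : ℕ) :
    (g • diagonal ![(1 : ℤ), (q : ℤ)]).map (Int.cast : ℤ → ℚ) = (g : ℚ) • diagonal ![(1 : ℚ), (q : ℚ)] := by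
  ext i j
  fin_cases i <;> fin_cases j <;> simp [diagonal]

/-- `det (A.map Int.cast) = det A` in `ℚ`. [folklore] -/
theorem det_map_intCast (A : Matrix (Fin 2) (Fin 2) ℤ) :
    (A.map (Int.cast : ℤ → ℚ)).det = (A.det : ℚ) := by
  have h := (Int.castRingHom ℚ).map_det A
  rw [eq_intCast] at h
  exact h.symm

/-! ### The theorem -/

/-- **Eichler orders of `M₂(ℚ)` are conjugate to the standard one.** For an Eichler order `O`
of level `M` of `M₂(ℚ)` there is `u ∈ GL₂(ℚ)` such that `z ∈ O` iff `u⁻¹ z u` has integer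
entries and `M` divides its `(1,0)` entry — i.e. `O = u (ℤ ℤ; Mℤ ℤ) u⁻¹` — and `M ≥ 1`
(Vignéras II §2: `O_N = (R R; NR R)`, l'ordre d'Eichler canonique de niveau `N`).
[cite: VignerasLNM800, Ch. II §2 (ordres d'Eichler de M(2,K)) and Ch. III §5] -/
theorem Brandt.IsEichlerOrder.exists_units_forall_mem_iff_and_pos
    {O : Submodule ℤ (Matrix (Fin 2) (Fin 2) ℚ)} {M : ℕ}
    (hO : Brandt.IsEichlerOrder (Matrix (Fin 2) (Fin 2) ℚ) O M) :
    ∃ u : (Matrix (Fin 2) (Fin 2) ℚ)ˣ, 0 < M ∧ ∀ z : Matrix (Fin 2) (Fin 2) ℚ, z ∈ O ↔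
      (∀ i j, ∃ n : ℤ, (((u⁻¹ : (Matrix (Fin 2) (Fin 2) ℚ)ˣ) : Matrix (Fin 2) (Fin 2) ℚ) * z * u) i j = n) ∧
        ∃ n : ℤ, (((u⁻¹ : (Matrix (Fin 2) (Fin 2) ℚ)ˣ) : Matrix (Fin 2) (Fin 2) ℚ) * z * u) 1 0 = M * n := by
  classical
  set MO : Submodule ℤ (Matrix (Fin 2) (Fin 2) ℚ) := matrixOrder ℤ ℚ with hMO
  obtain ⟨O₁, O₂, h₁, h₂, hO12, hidx⟩ := hO
  obtain ⟨g₁, hg₁⟩ := h₁.exists_eq_map_unitsConj_matrixOrder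
  obtain ⟨g₂, hg₂⟩ := h₂.exists_eq_map_unitsConj_matrixOrder
  set k : (Matrix (Fin 2) (Fin 2) ℚ)ˣ := g₁⁻¹ * g₂ with hk
  -- clear denominators: `N k = A` integral, `det A ≠ 0`
  obtain ⟨N, hN, hNk⟩ := (isFullLattice_matrixOrder (R := ℤ) (K := ℚ) rat_exists_zsmul_mem_range).2
    (k : Matrix (Fin 2) (Fin 2) ℚ)
  obtain ⟨A, hA⟩ := exists_eq_map_intCast_of_mem_matrixOrder hNk
  have hNq : (N : ℚ) ≠ 0 := Int.cast_ne_zero.mpr hN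
  have hdetk : (k : Matrix (Fin 2) (Fin 2) ℚ).det ≠ 0 :=
    ((Matrix.isUnit_iff_isUnit_det _).mp (Units.isUnit k)).ne_zero
  have hAdet : A.det ≠ 0 := by
    intro h0
    have h1 : (A.map (Int.cast : ℤ → ℚ)).det = 0 := by rw [det_map_intCast, h0, Int.cast_zero]
    rw [← hA, ← Int.cast_smul_eq_zsmul ℚ, det_smul, Fintype.card_fin] at h1
    exact (mul_ne_zero (pow_ne_zero _ hNq) hdetk) h1
  -- Smith normal form of `A`
  obtain ⟨P, Q, g, q, hP, hQ, hq, hg, hPQ⟩ :=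
    Literature.LinearAlgebra.Matrix.exists_smith_normal_form_fin_two_int A hAdet
  obtain ⟨γP, hγP, hγP1, hγP2⟩ := exists_units_coe_eq_map_intCast P hP
  obtain ⟨γQ, hγQ, hγQ1, hγQ2⟩ := exists_units_coe_eq_map_intCast Q hQ
  have hq0 : (q : ℚ) ≠ 0 := by exact_mod_cast hq.ne'
  obtain ⟨δ, hδ, -⟩ := exists_units_coe_eq_diagonal hq0
  -- `k = (g/N) • (γP δ γQ)`
  set w : (Matrix (Fin 2) (Fin 2) ℚ)ˣ := γP * δ * γQ with hw
  have hkw : (k : Matrix (Fin 2) (Fin 2) ℚ) = ((g : ℚ) / N) • (w : Matrix (Fin 2) (Fin 2) ℚ) := by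
    have hcast : A.map (Int.cast : ℤ → ℚ) =
        (γP : Matrix (Fin 2) (Fin 2) ℚ) * ((g : ℚ) • (δ : Matrix (Fin 2) (Fin 2) ℚ)) * γQ := by
      rw [hPQ]
      change (Int.castRingHom ℚ).mapMatrix (P * (g • diagonal ![(1 : ℤ), (q : ℤ)]) * Q) = _
      rw [map_mul, map_mul]
      change P.map (Int.cast : ℤ → ℚ) * (g • diagonal ![(1 : ℤ), (q : ℤ)]).map (Int.cast : ℤ → ℚ) *
        Q.map (Int.cast : ℤ → ℚ) = _
      rw [map_intCast_smul_diagonal, ← hγP, ← hγQ, ← hδ]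
    have e1 : (N : ℚ) • (k : Matrix (Fin 2) (Fin 2) ℚ) = (g : ℚ) • (w : Matrix (Fin 2) (Fin 2) ℚ) := by
      rw [Int.cast_smul_eq_zsmul, hA, hcast, hw, Units.val_mul, Units.val_mul, mul_smul_comm,
        smul_mul_assoc]
    rw [div_eq_mul_inv, mul_comm, ← smul_smul, ← e1, smul_smul, inv_mul_cancel₀ hNq, one_smul]
  -- the standard Eichler order of level `q` and the conjugator `u = g₁ γP`
  set E : Submodule ℤ (Matrix (Fin 2) (Fin 2) ℚ) :=
    MO ⊓ MO.map (unitsConj δ : Matrix (Fin 2) (Fin 2) ℚ →ₗ[ℤ] Matrix (Fin 2) (Fin 2) ℚ) with hE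
  set u : (Matrix (Fin 2) (Fin 2) ℚ)ˣ := g₁ * γP with hu
  have hMOk : MO.map (unitsConj k : Matrix (Fin 2) (Fin 2) ℚ →ₗ[ℤ] Matrix (Fin 2) (Fin 2) ℚ) =
      (MO.map (unitsConj δ : Matrix (Fin 2) (Fin 2) ℚ →ₗ[ℤ] Matrix (Fin 2) (Fin 2) ℚ)).map
        (unitsConj γP : Matrix (Fin 2) (Fin 2) ℚ →ₗ[ℤ] Matrix (Fin 2) (Fin 2) ℚ) := by
    rw [map_unitsConj_eq_of_coe_eq_smul hkw, hw, map_unitsConj_mul, map_unitsConj_mul,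
      map_unitsConj_matrixOrder_eq_of_mem γQ hγQ1 hγQ2]
  have hOE : O = E.map (unitsConj u : Matrix (Fin 2) (Fin 2) ℚ →ₗ[ℤ] Matrix (Fin 2) (Fin 2) ℚ) := by
    have hg₂' : g₂ = g₁ * k := by rw [hk, mul_inv_cancel_left]
    rw [hO12, hg₁, hg₂, hg₂', map_unitsConj_mul, hMOk, hu, map_unitsConj_mul, hE,
      Submodule.map_inf _ (unitsConj γP).injective, map_unitsConj_matrixOrder_eq_of_mem γP hγP1 hγP2,
      Submodule.map_inf _ (unitsConj g₁).injective]
  have hO₁u : O₁ = MO.map (unitsConj u : Matrix (Fin 2) (Fin 2) ℚ →ₗ[ℤ] Matrix (Fin 2) (Fin 2) ℚ) := by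
    rw [hg₁, hu, map_unitsConj_mul, map_unitsConj_matrixOrder_eq_of_mem γP hγP1 hγP2]
  -- the level: `M = [O₁ : O] = [M₂(ℤ) : E] = q`
  have hMq : M = q := by
    rw [← hidx, hOE, hO₁u, relIndex_map_unitsConj, hE, hMO]
    exact relIndex_inf_map_unitsConj_diagonal hq hδ
  refine ⟨u, hMq ▸ hq, fun z => ?_⟩
  rw [hOE, mem_map_unitsConj_iff, hE, hMO, mem_inf_map_unitsConj_diagonal_iff hq hδ, hMq]

/-- **Eichler orders of `M₂(ℚ)` are conjugate to the standard one** (form without the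
positivity clause). [cite: VignerasLNM800, Ch. II §2 (ordres d'Eichler de M(2,K)) and Ch. III §5] -/
theorem Brandt.IsEichlerOrder.exists_units_forall_mem_iff
    {O : Submodule ℤ (Matrix (Fin 2) (Fin 2) ℚ)} {M : ℕ}
    (hO : Brandt.IsEichlerOrder (Matrix (Fin 2) (Fin 2) ℚ) O M) :
    ∃ u : (Matrix (Fin 2) (Fin 2) ℚ)ˣ, ∀ z : Matrix (Fin 2) (Fin 2) ℚ, z ∈ O ↔
      (∀ i j, ∃ n : ℤ, (((u⁻¹ : (Matrix (Fin 2) (Fin 2) ℚ)ˣ) : Matrix (Fin 2) (Fin 2) ℚ) * z * u) i j = n) ∧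
        ∃ n : ℤ, (((u⁻¹ : (Matrix (Fin 2) (Fin 2) ℚ)ˣ) : Matrix (Fin 2) (Fin 2) ℚ) * z * u) 1 0 = M * n := by
  obtain ⟨u, -, hu⟩ := hO.exists_units_forall_mem_iff_and_pos
  exact ⟨u, hu⟩

/-- The level of an Eichler order of `M₂(ℚ)` is positive. [folklore] -/
theorem Brandt.IsEichlerOrder.level_pos {O : Submodule ℤ (Matrix (Fin 2) (Fin 2) ℚ)} {M : ℕ}
    (hO : Brandt.IsEichlerOrder (Matrix (Fin 2) (Fin 2) ℚ) O M) : 0 < M := by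
  obtain ⟨-, hM, -⟩ := hO.exists_units_forall_mem_iff_and_pos
  exact hM

end Literature.NumberTheory.Automorphic

end
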